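import Literature.Probability.Percolation.DiscreteDomainPaths
import Literature.Probability.Percolation.PlanarDuality
import Literature.Probability.Percolation.FourArmGarbanSquareDomain
import Mathlib.Analysis.Complex.ReImTopology

/-!
# The lattice box of the corner-marked rectangle `(0,W) × (0,H)`: mesh vertices, discrete domain, frontier

Support file for the reduction `RectilinearCardy → stub_rectCardyOne` of line
`two-cluster-rate-is-stationary-gap` (crux `StripClusterRates`, stmt-CriticalPhenomena-13878), part 1
of 2. Elementary facts about the discretisation (`meshVertices`, `meshGraph`, `meshDomain`,
`discreteDomainGraph`, Smirnov 2001 §2, tree `DomainDiscretisation.lean`) of the open box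
`Ω = Ioo 0 W ×ℂ Ioo 0 H` at mesh `δ > 0` (the carrier of the tree's Bollobás–Riordan rectangle
`brRect W H`), in the exact shape of the sibling file
`CardyBoundaryCoulombGasHalfPlaneMarkDensityLawBoxExhaustionPart1/2` (which treats the box
`Ioo (-K) K ×ℂ Ioo 0 H`; the proofs are the same):

* the mesh graph of the box is connected, so `meshDomain Ω δ = meshVertices Ω δ`
  (`meshDomain_obox`) and `Ω_δ` is the nearest-neighbour graph on the lattice box
  (`discreteDomainGraph_adj_obox`);
* the frontier of the box is the union of its four closed sides (`mem_frontier_obox`);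
* open lattice paths inside the lattice box are paths of `Ω_δ` (`reachable_of_openConnIn_obox`; the
  converse for any domain is the sibling's `BoxExhaustion.openConnIn_meshDomain_of_reachable`).
No definitions are introduced.
-/

noncomputable section

namespace Summit.CriticalPhenomena.CardyFormulaZ2.Cruxes.StripClusterRates.TwoClusterRateIsStationaryGap

open Set Metric Complex
open Literature.Probability.LatticeModels Literature.Probability.Percolation

variable {W H δ : ℝ}

namespace RectBox

/-! ## The box and its mesh vertices -/

/-- Membership in the box. [folklore] -/
theorem mem_obox {z : ℂ} :
    z ∈ Ioo 0 W ×ℂ Ioo 0 H ↔ (0 < z.re ∧ z.re < W) ∧ (0 < z.im ∧ z.im < H) := by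
  simp [mem_reProdIm]

/-- The box is convex. [folklore] -/
theorem convex_obox : Convex ℝ (Ioo 0 W ×ℂ Ioo 0 H) :=
  ((convex_Ioo _ _).linear_preimage reLm).inter ((convex_Ioo _ _).linear_preimage imLm)

/-- Mesh vertices of the box. [folklore] -/
theorem mem_meshVertices_obox {v : Site 2} :
    v ∈ meshVertices (Ioo 0 W ×ℂ Ioo 0 H) δ ↔
      (0 < δ * v 0 ∧ δ * v 0 < W) ∧ (0 < δ * v 1 ∧ δ * v 1 < H) := by
  rw [mem_meshVertices_iff, mem_obox, meshPoint_re, meshPoint_im]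

/-- Mesh vertices of the box, bounds divided by the mesh. [folklore] -/
theorem mem_meshVertices_obox_div (hδ : 0 < δ) {v : Site 2} :
    v ∈ meshVertices (Ioo 0 W ×ℂ Ioo 0 H) δ ↔
      (0 < v 0 ∧ (v 0 : ℝ) < W / δ) ∧ (0 < v 1 ∧ (v 1 : ℝ) < H / δ) := by
  rw [mem_meshVertices_obox, lt_div_iff₀ hδ, lt_div_iff₀ hδ, mul_comm (v 0 : ℝ), mul_comm (v 1 : ℝ)]
  constructor
  · rintro ⟨⟨h1, h2⟩, h3, h4⟩
    have h1' : (0 : ℝ) < v 0 := pos_of_mul_pos_right h1 hδ.le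
    have h3' : (0 : ℝ) < v 1 := pos_of_mul_pos_right h3 hδ.le
    exact ⟨⟨by exact_mod_cast h1', h2⟩, by exact_mod_cast h3', h4⟩
  · rintro ⟨⟨h1, h2⟩, h3, h4⟩
    have h1' : (0 : ℝ) < v 0 := by exact_mod_cast h1
    have h3' : (0 : ℝ) < v 1 := by exact_mod_cast h3
    exact ⟨⟨mul_pos hδ h1', h2⟩, mul_pos hδ h3', h4⟩

/-- Lattice neighbours inside the box are mesh-adjacent (the box is convex). [folklore] -/
theorem meshGraph_adj_obox {x y : Site 2} (hx : x ∈ meshVertices (Ioo 0 W ×ℂ Ioo 0 H) δ)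
    (hy : y ∈ meshVertices (Ioo 0 W ×ℂ Ioo 0 H) δ) (hxy : (zdGraph 2).Adj x y) :
    (meshGraph (Ioo 0 W ×ℂ Ioo 0 H) δ).Adj x y :=
  meshGraph_adj_iff.2 ⟨hxy, (convex_obox.segment_subset hx hy).trans subset_closure⟩

/-- **The mesh graph of the box is connected**: two mesh vertices are joined by a column move
followed by a row move inside the lattice box. [folklore] -/
theorem preconnected_meshVertexGraph_obox (hδ : 0 < δ) :
    (meshVertexGraph (Ioo 0 W ×ℂ Ioo 0 H) δ).Preconnected := by
  set V := meshVertices (Ioo 0 W ×ℂ Ioo 0 H) δ with hV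
  set G := meshVertexGraph (Ioo 0 W ×ℂ Ioo 0 H) δ with hG
  -- sites in coordinates
  have st_eta : ∀ v : Site 2, (![v 0, v 1] : Site 2) = v := fun v => by
    ext k; fin_cases k <;> rfl
  have adj_up : ∀ i j : ℤ, (zdGraph 2).Adj (![i, j] : Site 2) ![i, j + 1] := fun i j => by
    rw [zdGraph_adj_iff]
    refine ⟨1, Or.inl ?_⟩
    ext k; fin_cases k <;> simp
  have adj_right : ∀ i j : ℤ, (zdGraph 2).Adj (![i, j] : Site 2) ![i + 1, j] := fun i j => by
    rw [zdGraph_adj_iff]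
    refine ⟨0, Or.inl ?_⟩
    ext k; fin_cases k <;> simp
  have memV : ∀ i j : ℤ, (![i, j] : Site 2) ∈ V ↔
      (0 < i ∧ (i : ℝ) < W / δ) ∧ (0 < j ∧ (j : ℝ) < H / δ) := fun i j => by
    rw [hV, mem_meshVertices_obox_div hδ]; simp
  have adjG : ∀ {a b : Site 2} (ha : a ∈ V) (hb : b ∈ V), (zdGraph 2).Adj a b →
      G.Adj ⟨a, ha⟩ ⟨b, hb⟩ := by
    intro a b ha hb hab
    simp only [hG, SimpleGraph.comap_adj, Function.Embedding.coe_subtype]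
    exact meshGraph_adj_obox ha hb hab
  -- column moves
  have hcol : ∀ (i j : ℤ) (m : ℕ) (h0 : (![i, j] : Site 2) ∈ V) (h1 : (![i, j + m] : Site 2) ∈ V),
      G.Reachable ⟨![i, j], h0⟩ ⟨![i, j + m], h1⟩ := by
    intro i j m
    induction m with
    | zero =>
      intro h0 h1
      have e : (⟨![i, j + ((0 : ℕ) : ℤ)], h1⟩ : V) = ⟨![i, j], h0⟩ := Subtype.ext (by simp)
      rw [e]
    | succ m ih =>
      intro h0 h1
      have h0' := (memV _ _).1 h0
      have h1' := (memV _ _).1 h1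
      simp only [Int.cast_add, Int.cast_natCast, Nat.cast_succ] at h1'
      have hmid : (![i, j + m] : Site 2) ∈ V := by
        rw [memV]
        simp only [Int.cast_add, Int.cast_natCast]
        have hm : (0 : ℝ) ≤ m := Nat.cast_nonneg m
        refine ⟨h0'.1, ?_, by linarith [h1'.2.2]⟩
        have : (0 : ℤ) < j := h0'.2.1
        omega
      refine (ih h0 hmid).trans (SimpleGraph.Adj.reachable (adjG hmid h1 ?_))
      have := adj_up i (j + m)
      push_cast
      rwa [← add_assoc]
  have hcol' : ∀ (i j j' : ℤ) (h0 : (![i, j] : Site 2) ∈ V) (h1 : (![i, j'] : Site 2) ∈ V),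
      G.Reachable ⟨![i, j], h0⟩ ⟨![i, j'], h1⟩ := by
    intro i j j' h0 h1
    rcases le_total j j' with h | h
    · obtain ⟨m, rfl⟩ : ∃ m : ℕ, j' = j + m := ⟨(j' - j).toNat, by omega⟩
      exact hcol i j m h0 h1
    · obtain ⟨m, rfl⟩ : ∃ m : ℕ, j = j' + m := ⟨(j - j').toNat, by omega⟩
      exact (hcol i j' m h1 h0).symm
  -- row moves
  have hrow : ∀ (i j : ℤ) (m : ℕ) (h0 : (![i, j] : Site 2) ∈ V) (h1 : (![i + m, j] : Site 2) ∈ V),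
      G.Reachable ⟨![i, j], h0⟩ ⟨![i + m, j], h1⟩ := by
    intro i j m
    induction m with
    | zero =>
      intro h0 h1
      have e : (⟨![i + ((0 : ℕ) : ℤ), j], h1⟩ : V) = ⟨![i, j], h0⟩ := Subtype.ext (by simp)
      rw [e]
    | succ m ih =>
      intro h0 h1
      have h0' := (memV _ _).1 h0
      have h1' := (memV _ _).1 h1
      simp only [Int.cast_add, Int.cast_natCast, Nat.cast_succ] at h1'
      have hmid : (![i + m, j] : Site 2) ∈ V := by
        rw [memV]
        simp only [Int.cast_add, Int.cast_natCast]
        have hm : (0 : ℝ) ≤ m := Nat.cast_nonneg m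
        refine ⟨⟨?_, by linarith [h1'.1.2]⟩, h0'.2⟩
        have : (0 : ℤ) < i := h0'.1.1
        omega
      refine (ih h0 hmid).trans (SimpleGraph.Adj.reachable (adjG hmid h1 ?_))
      have := adj_right (i + m) j
      push_cast
      rwa [← add_assoc]
  have hrow' : ∀ (i i' j : ℤ) (h0 : (![i, j] : Site 2) ∈ V) (h1 : (![i', j] : Site 2) ∈ V),
      G.Reachable ⟨![i, j], h0⟩ ⟨![i', j], h1⟩ := by
    intro i i' j h0 h1
    rcases le_total i i' with h | h
    · obtain ⟨m, rfl⟩ : ∃ m : ℕ, i' = i + m := ⟨(i' - i).toNat, by omega⟩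
      exact hrow i j m h0 h1
    · obtain ⟨m, rfl⟩ : ∃ m : ℕ, i = i' + m := ⟨(i - i').toNat, by omega⟩
      exact (hrow i' j m h1 h0).symm
  rintro ⟨u, hu⟩ ⟨v, hv⟩
  have hu0 : (![u 0, u 1] : Site 2) ∈ V := by rwa [st_eta]
  have hv0 : (![v 0, v 1] : Site 2) ∈ V := by rwa [st_eta]
  have hu' := (memV _ _).1 hu0
  have hv' := (memV _ _).1 hv0
  have hw : (![u 0, v 1] : Site 2) ∈ V := (memV _ _).2 ⟨hu'.1, hv'.2⟩
  have e1 : (⟨![u 0, u 1], hu0⟩ : V) = ⟨u, hu⟩ := Subtype.ext (st_eta u)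
  have e2 : (⟨![v 0, v 1], hv0⟩ : V) = ⟨v, hv⟩ := Subtype.ext (st_eta v)
  have h := (hcol' (u 0) (u 1) (v 1) hu0 hw).trans (hrow' (u 0) (v 0) (v 1) hw hv0)
  rwa [e1, e2] at h

/-- **The discrete box is the whole lattice box**: `meshDomain = meshVertices` for the box
(tree: `meshDomain_eq_meshVertices_of_preconnected`). [folklore] -/
theorem meshDomain_obox (hδ : 0 < δ) :
    meshDomain (Ioo 0 W ×ℂ Ioo 0 H) δ = meshVertices (Ioo 0 W ×ℂ Ioo 0 H) δ :=
  meshDomain_eq_meshVertices_of_preconnected (preconnected_meshVertexGraph_obox hδ)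

/-- Adjacency in `Ω_δ` for the box is lattice adjacency between mesh vertices. [folklore] -/
theorem discreteDomainGraph_adj_obox (hδ : 0 < δ) {x y : Site 2} :
    (discreteDomainGraph (Ioo 0 W ×ℂ Ioo 0 H) δ).Adj x y ↔
      (zdGraph 2).Adj x y ∧ x ∈ meshVertices (Ioo 0 W ×ℂ Ioo 0 H) δ ∧
        y ∈ meshVertices (Ioo 0 W ×ℂ Ioo 0 H) δ := by
  rw [discreteDomainGraph_adj_iff, meshDomain_obox hδ]
  constructor
  · rintro ⟨h, hx, hy⟩; exact ⟨(meshGraph_adj_iff.1 h).1, hx, hy⟩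
  · rintro ⟨h, hx, hy⟩; exact ⟨meshGraph_adj_obox hx hy h, hx, hy⟩

/-- A vertex of the discrete boundary of the box has a lattice neighbour outside the lattice box.
[folklore] -/
theorem exists_adj_not_mem_of_mem_meshBoundary_obox (hδ : 0 < δ) {v : Site 2}
    (hv : v ∈ meshBoundary (Ioo 0 W ×ℂ Ioo 0 H) δ) :
    v ∈ meshVertices (Ioo 0 W ×ℂ Ioo 0 H) δ ∧
      ∃ w, (zdGraph 2).Adj v w ∧ w ∉ meshVertices (Ioo 0 W ×ℂ Ioo 0 H) δ := by
  obtain ⟨hvD, w, hvw, hnadj⟩ := hv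
  have hvV : v ∈ meshVertices (Ioo 0 W ×ℂ Ioo 0 H) δ := by rwa [meshDomain_obox hδ] at hvD
  rw [discreteDomainGraph_adj_obox hδ] at hnadj
  exact ⟨hvV, w, hvw, fun h => hnadj ⟨hvw, hvV, h⟩⟩

/-- A mesh vertex of the box with a lattice neighbour outside the lattice box is a discrete
boundary vertex. [folklore] -/
theorem mem_meshBoundary_obox (hδ : 0 < δ) {v w : Site 2}
    (hv : v ∈ meshVertices (Ioo 0 W ×ℂ Ioo 0 H) δ) (hvw : (zdGraph 2).Adj v w)
    (hw : w ∉ meshVertices (Ioo 0 W ×ℂ Ioo 0 H) δ) :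
    v ∈ meshBoundary (Ioo 0 W ×ℂ Ioo 0 H) δ := by
  refine ⟨by rwa [meshDomain_obox hδ], w, hvw, ?_⟩
  rw [discreteDomainGraph_adj_obox hδ]
  exact fun h => hw h.2.2

/-! ## The frontier of the box -/

/-- The frontier of the box: the four closed sides. [folklore] -/
theorem mem_frontier_obox (hW : 0 < W) (hH : 0 < H) {q : ℂ} :
    q ∈ frontier (Ioo 0 W ×ℂ Ioo 0 H) ↔
      (q.re ∈ Icc 0 W ∧ (q.im = 0 ∨ q.im = H)) ∨ ((q.re = 0 ∨ q.re = W) ∧ q.im ∈ Icc 0 H) := by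
  rw [frontier_reProdIm, closure_Ioo hW.ne, frontier_Ioo hH, closure_Ioo hH.ne, frontier_Ioo hW]
  simp [mem_reProdIm]

/-! ## Open paths of `Ω_δ` versus open lattice paths in the lattice box -/

/-- **An open lattice path inside the lattice box is an open path of `Ω_δ`** (for a lattice
configuration `ω ⊆ E(ℤ²)`). [folklore] -/
theorem reachable_of_openConnIn_obox (hδ : 0 < δ) {ω : BondConfig (Site 2)}
    (hωE : ω ⊆ (zdGraph 2).edgeSet) {x y : Site 2}
    (h : ω ∈ openConnIn (meshVertices (Ioo 0 W ×ℂ Ioo 0 H) δ) x y) :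
    (openGraph ω ⊓ discreteDomainGraph (Ioo 0 W ×ℂ Ioo 0 H) δ).Reachable x y := by
  obtain ⟨hx, hy, ⟨p⟩⟩ := h
  set V := meshVertices (Ioo 0 W ×ℂ Ioo 0 H) δ
  suffices H' : ∀ (a b : V) (p : ((openGraph ω).induce V).Walk a b),
      (openGraph ω ⊓ discreteDomainGraph (Ioo 0 W ×ℂ Ioo 0 H) δ).Reachable a b from H' _ _ p
  intro a b p
  induction p with
  | nil => exact SimpleGraph.Reachable.refl _
  | @cons a b c hab p ih =>
    have hab' : (openGraph ω).Adj a b := hab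
    obtain ⟨hmem, -⟩ := (openGraph_adj _ _ _).1 hab'
    have hzd : (zdGraph 2).Adj a b := by
      have := hωE hmem
      rwa [SimpleGraph.mem_edgeSet] at this
    refine (SimpleGraph.Adj.reachable ?_).trans ih
    refine open_inf_discreteDomainGraph_adj_iff.2 ⟨hmem, meshGraph_adj_obox a.2 b.2 hzd, ?_, ?_⟩
    · rw [meshDomain_obox hδ]; exact a.2
    · rw [meshDomain_obox hδ]; exact b.2

end RectBox

/-- Registered sub-goal of this support file (part 1 of the reduction `RectilinearCardy → stub_rectCardyOne`):
the discrete box of `(0,W) × (0,H)` is the whole lattice box. [folklore] -/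
theorem rc_meshDomain_obox :
    ∀ W H δ : ℝ, 0 < δ →
      Literature.Probability.LatticeModels.meshDomain (Set.Ioo (0 : ℝ) W ×ℂ Set.Ioo (0 : ℝ) H) δ =
        Literature.Probability.LatticeModels.meshVertices (Set.Ioo (0 : ℝ) W ×ℂ Set.Ioo (0 : ℝ) H) δ :=
  fun _ _ _ hδ => RectBox.meshDomain_obox hδ

end Summit.CriticalPhenomena.CardyFormulaZ2.Cruxes.StripClusterRates.TwoClusterRateIsStationaryGap

end
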